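import Summits.BirchSwinnertonDyer.BirchSwinnertonDyer.Theorems.AlignedTransportAtTwoMainConjectureTransportAlignedAtTwoDepletedPeriodFormula
import Summits.BirchSwinnertonDyer.BirchSwinnertonDyer.Theorems.AlignedTransportAtTwoMainConjectureTransportAlignedAtTwoSigmaSymbolParity
import Literature.NumberTheory.EllipticCurves.PAdicLFunctionIntegralityProofs
import HarnessLib

/-!
# Crux C1 `MainConjectureTransportAlignedAtTwo` (stmt-BirchSwinnertonDyer-22296), line `birth`, plan «ord-plusline» step (N):
# TOOLS — the depleted `μ = 0` certificate, cusps `Γ₀(N')`-equivalent to `0`, integrality of the depleted period functional on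
# `H₁(X₀(N'); ℤ)`, and the `T_q`-transport of the cusp `0` (lead att-p1 g9; `--supports 22296`)

THEOREMS ONLY (no `def`, no `sorry`, no named fact). BSD is not proved by this; C1 is not closed by this.

* §1 `exists_depleted_table_norm_gt_one` — for `W` good ordinary at `2`, newform `f`, even-branch lift `G` and a list `l` of odd places: if
  `red ((∏_{v∈l} 𝒫_v^ι)·G) ≠ 0` then SOME depleted plus-symbol table value `(eulerDepleteTableList W l [·]⁺_f)(m/2ᵏ)` is NOT `2`-integral
  (otherwise the depleted Mazur–Swinnerton-Dyer measure is `ℤ₂`-valued and even, so its transform lies in `2Λ`: the `Δ = {±1}` doubling,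
  `norm_coeff_distributionTransform_le_half_of_even`; depleted twin of `…SigmaSymbolParityNamed.exists_symbol_not_integral_of_red_ne_zero`).
* §2 `exists_gamma0_modularSymbol_div_eq` — a cusp `B/D` with `D` prime to `B·N'` is `γ·0` for an explicit `γ ∈ Γ₀(N')`, uniformly for every
  cusp form: `{∞, B/D}_h = {∞, γ∞}_h + {∞, 0}_h`.
* §3 `exists_int_depleted_periodFunctional` — for the `S`-depleted form `g` of the newform `f` of `W` at a level `L ⊇ N_W∏ℓ²` and `D = ∏ℓ²`:
  `(2D/Ω⁺_f)·re x(g) ∈ ℤ` for every `x ∈ periodHomology L` (`D·{∞,γ∞}_g ∈ Λ_f`, `re Λ_f = ℤ·Ω⁺_f/2`).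
* §4 `exists_heckeT_transport_zero` — `(a − q − 1)·{∞,0}_h = Σ_{j<q} {∞, γⱼ∞}_h` for `T_q h = a·h`, `q ∤ N'` prime (`γⱼ·0 = j/q`), with ONE family
  `(γⱼ)` serving every cusp form of level `N'`.

References: Mazur–Tate–Teitelbaum, Invent. Math. 84 (1986) §I.10 [MazurTateTeitelbaum1986Invent]; Manin 1972 Prop. 1.4, Thm. 1.6 [Manin1972];
Cremona, *Algorithms* (1997) §2.2, §2.8 [CremonaAlgorithms1997]; Greenberg–Vatsal 2000 §1 (8) [GreenbergVatsal2000].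
-/

noncomputable section

-- justification: the `Summit.BirchSwinnertonDyer.BirchSwinnertonDyer.…` path repeats a component (route-file convention)
set_option linter.dupNamespace false

open scoped MatrixGroups ModularForm NumberField Classical
open CongruenceSubgroup Complex WeierstrassCurve IsDedekindDomain PowerSeries
open Literature.NumberTheory.EllipticCurves Literature.NumberTheory.EllipticCurves.ModularForms
open Literature.NumberTheory.EllipticCurves.Greenberg1999 Literature.NumberTheory.EllipticCurves.GreenbergVatsal2000
open Summit.BirchSwinnertonDyer.Rank1Residual.F1Sign2 Summit.BirchSwinnertonDyer.Rank1Residual.X1.MuLambda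
open Summit.BirchSwinnertonDyer.BirchSwinnertonDyer.Theorems.AlignedTransportAtTwoSigmaGlue
open Summit.BirchSwinnertonDyer.BirchSwinnertonDyer.Theorems.AlignedTransportAtTwoClosure
open Summit.BirchSwinnertonDyer.BirchSwinnertonDyer.Theorems.AlignedTransportAtTwoSymbolParity
open Summit.BirchSwinnertonDyer.BirchSwinnertonDyer.Theorems.ThetaLayerLambdaCongruenceAtTwo
open Summit.BirchSwinnertonDyer.BirchSwinnertonDyer.Theorems.MazurTateCongruenceAtTwoR.DepletedLattice

namespace Summit.BirchSwinnertonDyer.BirchSwinnertonDyer.Theorems.AlignedTransportAtTwoOrdPlusLineTools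

/-! ## §1 The depleted `μ = 0` certificate: a non-integral depleted table value -/

section MuCertificate

variable {N : ℕ} [NeZero N] {f : CuspForm (Gamma0 N) 2} (W : WeierstrassCurve ℚ) [W.IsElliptic] [W.IsGloballyMinimal]

/-- **`red ((∏_{v∈l} 𝒫_v^ι)·G) ≠ 0` forces a non-`2`-integral DEPLETED plus symbol on a `2`-power cusp.** For `W` good ordinary at `2` without rational
`2`-torsion abscissa, its newform `f`, an even-branch lift `G` and a list `l` of odd places: if every value
`(eulerDepleteTableList W l [·]⁺_f)(m/2ᵏ)` were `2`-integral, the depleted Mazur–Swinnerton-Dyer measure would be `ℤ₂`-valued (unit root `≡ 1`), even,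
and its transform `ι((∏𝒫^ι)·G)` would have all coefficients in `2ℤ₂` (`norm_coeff_distributionTransform_le_half_of_even`), i.e. `red = 0`.
[cite: MazurTateTeitelbaum1986Invent, §I.10 (10.1) and §I.13] [cite: GreenbergVatsal2000, §1 (8)–(10)] -/
theorem exists_depleted_table_norm_gt_one (hord : IsOrdinaryAt W 2) (ht : ∀ x : ℚ, ¬ HasRationalTwoTorsionX W x) (hf : IsNewformOf W f)
    (l : List (HeightOneSpectrum (𝓞 ℚ))) (hl : ∀ v ∈ l, Rat.HeightOneSpectrum.natGenerator v ≠ 2)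
    {G : IwasawaAlgebra 2} (hG : IsEvenBranchLiftAtTwo W f G) (hred : red ((l.map (eulerFactorElementInv W 2)).prod * G) ≠ 0) :
    ∃ m k : ℕ, 1 < ‖((eulerDepleteTableList W l (ratPlusSymbol f) ((m : ℚ) / (2 : ℚ) ^ k) : ℚ) : ℚ_[2])‖ := by
  by_contra hall
  push Not at hall
  apply hred
  have hι := iwasawaToPowerSeries_eq_of_isEvenBranchLiftAtTwo_of_isOrdinaryAt W hord hG
  have hirr := irr_two_of_forall_not_hasRationalTwoTorsionX W ht
  obtain ⟨n₁, h2n₁, h01⟩ := exists_intCast_mul_modularSymbol_zero_mem (p := 2) not_irreducible_of_frobeniusTrace_congr_holds hf hirr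
  have hd := msdMeasure_distribution_of_isNewformOf hord hf
  have hb := norm_msdMeasure_two_le_two hord hf h2n₁ h01
  have hu : IsUnit (unitRoot W 2) := (unitRoot_spec_holds W 2 hord).2
  obtain ⟨hdD, -, htD⟩ := eulerDepleteList_spec W l hl hd hb
  have heD := eulerDepleteList_neg W (p := 2) l (msdMeasure_neg f (unitRoot W 2 : ℚ_[2]))
  have hvD := eulerDepleteList_msdMeasure_succ W (p := 2) f l (unitRoot W 2 : ℚ_[2])
  set D := eulerDepleteList W 2 l (msdMeasure f (unitRoot W 2 : ℚ_[2])) with hD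
  have hT : distributionTransform D = iwasawaToPowerSeries 2 ((l.map (eulerFactorElementInv W 2)).prod * G) := by
    rw [htD, ← padicLFunction_eq_distributionTransform, ← hι, map_mul]
  -- the depleted measure is `ℤ₂`-valued
  have hα : ‖((unitRoot W 2 : ℚ_[2]))⁻¹‖ = 1 := by
    rw [norm_inv, PadicInt.padic_norm_e_of_padicInt, PadicInt.isUnit_iff.mp hu, inv_one]
  have hpow : ∀ j : ℕ, ‖((unitRoot W 2 : ℚ_[2]))⁻¹ ^ j‖ ≤ 1 := fun j ↦ by rw [norm_pow, hα, one_pow]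
  have hterm : ∀ (j : ℕ) (x : ℚ), (∃ m k : ℕ, x = (m : ℚ) / (2 : ℚ) ^ k) →
      ‖((unitRoot W 2 : ℚ_[2]))⁻¹ ^ j * ((eulerDepleteTableList W l (ratPlusSymbol f) x : ℚ) : ℚ_[2])‖ ≤ 1 := by
    rintro j x ⟨m, k, rfl⟩
    rw [norm_mul]
    exact mul_le_one₀ (hpow j) (norm_nonneg _) (hall m k)
  have hsucc : ∀ (n : ℕ) (a : ZMod (2 ^ (n + 1))), ‖D (n + 1) a‖ ≤ 1 := by
    intro n a
    rw [hvD, sub_eq_add_neg]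
    have hcast : ((2 : ℕ) : ℚ) = (2 : ℚ) := by norm_num
    refine (Padic.nonarchimedean _ _).trans (max_le ?_ ?_)
    · rw [hcast]; exact hterm _ _ ⟨a.val, n + 1, rfl⟩
    · rw [norm_neg, hcast]; exact hterm _ _ ⟨a.val, n, rfl⟩
  have hbD : ∀ (n : ℕ) (a : ZMod (2 ^ n)), ‖D n a‖ ≤ 1 := by
    intro n a
    cases n with
    | zero =>
      rw [← hdD 0 a]
      exact IsUltrametricDist.norm_sum_le_of_forall_le_of_nonneg zero_le_one fun b _ ↦ hsucc 0 b
    | succ n => exact hsucc n a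
  -- hence its transform has coefficients in `2ℤ₂`
  have hcoeff : ∀ k : ℕ, ‖PowerSeries.coeff k (distributionTransform D)‖ ≤ 1 / 2 :=
    norm_coeff_distributionTransform_le_half_of_even heD hdD hbD
  refine (red_eq_of_norm_coeff_sub_le_half fun k ↦ ?_).trans (map_zero _)
  rw [map_zero, map_zero, sub_zero, ← hT]
  have h := hcoeff k
  norm_num at h ⊢
  exact h

end MuCertificate

/-! ## §2 Cusps with denominator prime to the level are `γ·0` -/

section Cusps

variable {N' : ℕ} [NeZero N']

/-- **`B/D = γ·0` with an explicit `γ = (u, B; −vN', D) ∈ Γ₀(N')`** when `D` is prime to `B·N'` (`uD + vBN' = 1`), read through Manin's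
relation for EVERY cusp form of level `N'`: `{∞, B/D}_h = {∞, γ∞}_h + {∞, 0}_h`. [cite: Manin1972, Prop. 1.4 and Thm. 1.6] -/
theorem exists_gamma0_modularSymbol_div_eq {B D : ℤ} (hD : D ≠ 0) (hcop : IsCoprime D (B * N')) :
    ∃ γ : Gamma0 N', ∀ h : CuspForm (Gamma0 N') 2, modularSymbol h ((B : ℚ) / D) = cuspSymbol h γ + modularSymbol h 0 := by
  obtain ⟨u, v, huv⟩ := hcop
  let γ : SL(2, ℤ) := ⟨!![u, B; -(v * N'), D], by
    rw [Matrix.det_fin_two_of]; linear_combination huv⟩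
  have hγ0 : γ ∈ Gamma0 N' := by
    rw [Gamma0_mem]
    show (((-(v * N') : ℤ)) : ZMod N') = 0
    push_cast
    rw [ZMod.natCast_self, mul_zero, neg_zero]
  have hDQ : (D : ℚ) ≠ 0 := by exact_mod_cast hD
  have hne : ((γ 1 0 : ℤ) : ℚ) * 0 + ((γ 1 1 : ℤ) : ℚ) ≠ 0 := by
    rw [mul_zero, zero_add]
    exact hDQ
  refine ⟨⟨γ, hγ0⟩, fun h ↦ ?_⟩
  have key := modularSymbol_gamma0_smul_holds h ⟨γ, hγ0⟩ 0 hne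
  have hquot : (((γ 0 0 : ℤ) : ℚ) * 0 + ((γ 0 1 : ℤ) : ℚ)) /
      (((γ 1 0 : ℤ) : ℚ) * 0 + ((γ 1 1 : ℤ) : ℚ)) = (B : ℚ) / D := by
    rw [mul_zero, zero_add, mul_zero, zero_add]
    rfl
  rw [hquot] at key
  exact key

/-- **Every `r ∈ ℚ` with `gcd(den r, N') = 1` is `γ·0`** for one `γ ∈ Γ₀(N')` serving all cusp forms of level `N'`.
[cite: Manin1972, Prop. 1.4 and Thm. 1.6] -/
theorem exists_gamma0_modularSymbol_eq_of_coprime_den {r : ℚ} (hr : Nat.Coprime r.den N') :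
    ∃ γ : Gamma0 N', ∀ h : CuspForm (Gamma0 N') 2, modularSymbol h r = cuspSymbol h γ + modularSymbol h 0 := by
  have h1 : IsCoprime (r.den : ℤ) r.num := by
    rw [Int.isCoprime_iff_gcd_eq_one, Int.gcd_comm, Int.gcd, Int.natAbs_natCast]
    exact r.reduced
  have h2 : IsCoprime (r.den : ℤ) (N' : ℤ) := Nat.isCoprime_iff_coprime.mpr hr
  obtain ⟨γ, hγ⟩ := exists_gamma0_modularSymbol_div_eq (N' := N') (B := r.num) (D := r.den)
    (by exact_mod_cast r.den_ne_zero) (h1.mul_right h2)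
  refine ⟨γ, fun h ↦ ?_⟩
  have hr' : ((r.num : ℤ) : ℚ) / ((r.den : ℤ) : ℚ) = r := by
    push_cast
    exact Rat.num_div_den r
  rw [← hγ h, hr']

omit [NeZero N'] in
/-- A `2`-power cusp `m/2ᵏ` has denominator prime to an odd `N'`. [folklore] -/
theorem coprime_den_twoPow (hN' : Odd N') (m k : ℕ) : Nat.Coprime ((m : ℚ) / (2 : ℚ) ^ k).den N' := by
  have h2N : Nat.Coprime (2 ^ k) N' := Nat.Coprime.pow_left k ((Nat.Prime.coprime_iff_not_dvd Nat.prime_two).mpr hN'.not_two_dvd_nat)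
  have hdvd : ((m : ℚ) / (2 : ℚ) ^ k).den ∣ 2 ^ k := by
    have h := Rat.den_dvd (m : ℤ) (2 ^ k : ℕ)
    rw [Rat.divInt_eq_div] at h
    push_cast at h
    exact_mod_cast h
  exact Nat.Coprime.coprime_dvd_left hdvd h2N

end Cusps

/-! ## §3 Integrality of the depleted period functional on `H₁(X₀(L); ℤ)` -/

section Integrality

variable {N : ℕ} [NeZero N] {f : CuspForm (Gamma0 N) 2} (W : WeierstrassCurve ℚ)

/-- **`(2D/Ω⁺_f) · re x(g) ∈ ℤ` on the period homology**, `D = ∏_{ℓ∈S} ℓ²`, for the `S`-depleted form `g` of the newform `f` of `W` at any level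
`L` with `N∏ℓ² ∣ L`: on generators `D·{∞,γ∞}_g ∈ Λ_f` (`DepletedLattice.mul_cuspSymbol_depleted_mem`) and `re Λ_f = ℤ·Ω⁺_f/2`; closure under
`0, +, −`. [cite: CremonaAlgorithms1997, §2.8] [cite: AtkinLehner1970, §3] -/
theorem exists_int_depleted_periodFunctional [W.IsElliptic] [W.IsGloballyMinimal] (hf : IsNewformOf W f)
    (S : Finset ℕ) (hS : ∀ ℓ ∈ S, ℓ.Prime) (L : ℕ) [NeZero L] (hNL : N * ∏ ℓ ∈ S, ℓ ^ 2 ∣ L)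
    (g : CuspForm (Gamma0 L) 2) (hg : ∀ n : ℕ, cuspCoeff g n = if ∃ ℓ ∈ S, ℓ ∣ n then 0 else cuspCoeff f n) :
    ∀ x ∈ periodHomology L, ∃ z : ℤ, (2 * ((∏ ℓ ∈ S, ℓ ^ 2 : ℕ) : ℝ) / plusPeriod f) * (x g).re = z := by
  have hint : ∀ n : ℕ, ∃ z : ℤ, cuspCoeff f n = z := fun n ↦ ⟨W.LFunction n, hf.2 n⟩
  have hTf : ∀ (p : ℕ) (hp : p.Prime), (haveI : NeZero p := ⟨hp.ne_zero⟩; heckeT (Gamma0 N) 2 p f) = cuspCoeff f p • f :=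
    fun p hp ↦ by haveI : NeZero p := ⟨hp.ne_zero⟩; exact hf.1.heckeT_eq_coeff_smul hp
  have hΩ : 0 < plusPeriod f := IsNewform0.plusPeriod_pos_holds hf.1 hf.coeffField_eq_bot
  have hre := (realPeriods_eq_zmultiples_of_plusPeriod_ne_zero f hΩ.ne').1
  intro x hx
  refine AddSubgroup.closure_induction (p := fun x _ ↦ ∃ z : ℤ, (2 * ((∏ ℓ ∈ S, ℓ ^ 2 : ℕ) : ℝ) / plusPeriod f) * (x g).re = z)
    ?_ ?_ ?_ ?_ hx
  · rintro _ ⟨γ, rfl⟩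
    have hmem := mul_cuspSymbol_depleted_mem f hint hTf S hS L hNL g hg γ
    have hreal : (((∏ ℓ ∈ S, ℓ ^ 2 : ℕ) : ℂ) * cuspSymbol g γ).re ∈ realPeriods f := AddSubgroup.mem_map_of_mem _ hmem
    rw [hre, AddSubgroup.mem_zmultiples_iff] at hreal
    obtain ⟨k, hk⟩ := hreal
    refine ⟨k, ?_⟩
    rw [periodFunctional_apply]
    have e : (((∏ ℓ ∈ S, ℓ ^ 2 : ℕ) : ℂ) * cuspSymbol g γ).re = ((∏ ℓ ∈ S, ℓ ^ 2 : ℕ) : ℝ) * (cuspSymbol g γ).re := by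
      rw [← Complex.ofReal_natCast, Complex.re_ofReal_mul]
    rw [e, zsmul_eq_mul] at hk
    rw [div_mul_eq_mul_div, div_eq_iff hΩ.ne']
    linear_combination (-2 : ℝ) * hk
  · exact ⟨0, by simp⟩
  · rintro x y _ _ ⟨zx, hzx⟩ ⟨zy, hzy⟩
    exact ⟨zx + zy, by rw [LinearMap.add_apply, Complex.add_re, mul_add, hzx, hzy]; push_cast; ring⟩
  · rintro x _ ⟨zx, hzx⟩
    exact ⟨-zx, by rw [LinearMap.neg_apply, Complex.neg_re, mul_neg, hzx]; push_cast; ring⟩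

end Integrality

/-! ## §4 The `T_q`-transport of the cusp `0` -/

section Transport

variable {N' : ℕ} [NeZero N']

/-- **`(a − q − 1)·{∞, 0}_h = Σ_{j<q} {∞, γⱼ∞}_h` whenever `T_q h = a·h`**, `q ∤ N'` prime, with ONE family `γⱼ ∈ Γ₀(N')` (`γⱼ·0 = j/q`, `γ₀ = 1`)
serving every cusp form of level `N'` (so that two eigenforms are transported by the SAME homology classes): `modularSymbol_heckeT` at `r = 0`
plus §2. [cite: CremonaAlgorithms1997, §2.8 (2.8.8)] [cite: Manin1972, §3] -/
theorem exists_heckeT_transport_zero {q : ℕ} (hq : q.Prime) (hqN : ¬ q ∣ N') :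
    ∃ γs : Fin q → Gamma0 N', ∀ (h : CuspForm (Gamma0 N') 2) (a : ℂ),
      (haveI : NeZero q := ⟨hq.ne_zero⟩; heckeT (Gamma0 N') 2 q h) = a • h →
      (a - q - 1) * modularSymbol h 0 = ∑ j : Fin q, cuspSymbol h (γs j) := by
  haveI : NeZero q := ⟨hq.ne_zero⟩
  -- the family `γⱼ`
  have hγ : ∀ j : Fin q, ∃ γ : Gamma0 N', ∀ h : CuspForm (Gamma0 N') 2,
      modularSymbol h (((0 : ℚ) + j) / q) = cuspSymbol h γ + modularSymbol h 0 := by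
    intro j
    have hcop : Nat.Coprime ((((0 : ℚ) + j) / q).den) N' := by
      have hqN' : Nat.Coprime q N' := (Nat.Prime.coprime_iff_not_dvd hq).mpr hqN
      have hdvd : ((((0 : ℚ) + j) / q).den) ∣ q := by
        have h := Rat.den_dvd ((j : ℕ) : ℤ) q
        rw [Rat.divInt_eq_div] at h
        push_cast at h
        rw [zero_add]
        exact_mod_cast h
      exact Nat.Coprime.coprime_dvd_left hdvd hqN'
    exact exists_gamma0_modularSymbol_eq_of_coprime_den hcop
  choose γs hγs using hγ
  refine ⟨γs, fun h a ha ↦ ?_⟩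
  have hH := modularSymbol_heckeT (f := h) (p := q) hq hqN 0
  rw [ha, modularSymbol_const_smul, mul_zero] at hH
  simp_rw [hγs _ h] at hH
  rw [Finset.sum_add_distrib, Finset.sum_const, Finset.card_univ, Fintype.card_fin, nsmul_eq_mul] at hH
  linear_combination hH

end Transport

end Summit.BirchSwinnertonDyer.BirchSwinnertonDyer.Theorems.AlignedTransportAtTwoOrdPlusLineTools

end
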